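import Literature.Geometry.Lorentzian.DataEmbeddingNormalSmooth
import Literature.Geometry.Lorentzian.Hypersurface
import HarnessLib

/-!
# The future unit normal field of a smooth spacelike hypersurface — unbundled (Part 1 of 2)

Part 1 (this file): the construction read in trivialisations (`coordMetric` … `futureUnitNormal`), smoothness of the
coordinate expressions at `x₀`, and the pointwise algebra up to `coordMetric_coordNormal_self`. Part 2
(`SpacelikeNormalField.lean`, which imports this file and opens this namespace): timelikeness and normalisation of `N`,
`isFutureUnitNormal_futureUnitNormal`, uniqueness, smoothness of the unit normal, assembly, spacelike immersions.
Split of the single 592-line HOME file of `decomp-fsc` lens-4 g25 (packet B) at the census desk's request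
(lint `statement-form`: Theorems files with proofs ≤ 400 lines); no statement or proof was changed.

For a spacetime `𝒮 = (M, g, τ)` of dimension `n + 1` (`Literature.Geometry.Lorentzian.Spacetime`) and a smooth map
`f : X → M` from an `n`-manifold whose differential is positive definite for `g` (`0 < g(df v, df v)` for `v ≠ 0`; e.g. a
spacelike immersion, `PseudoRiemannianMetric.IsSpacelikeImmersion`) we construct THE future unit normal field
`futureUnitNormal 𝒮 f : Π x, T_{f x} M` and prove

* `isFutureUnitNormal_futureUnitNormal` — it is a future unit normal along `f` (`LorentzianMetric.IsFutureUnitNormal`: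
  `g(ν, df v) = 0`, `g(ν, ν) = -1`, `ν` future-directed);
* `eq_futureUnitNormal` — uniqueness: every future unit normal field along `f` is this one;
* `contMDiffAt_futureUnitNormal` / `contMDiff_futureUnitNormal` — it is `C^∞` as a map `X → TM`;
* `exists_isFutureUnitNormal_contMDiff` — packaged existence statement, and the `IsSpacelikeImmersion` corollaries.

This is the construction of the tree's `DataEmbeddingNormalSmooth` (which proves smoothness of the normal FIELD OF A DATA
EMBEDDING, a datum of the structure `DataEmbedding`) re-run with the data embedding replaced by a bare smooth map with
positive-definite differential: Gram–Schmidt against the orienting field `T` read in trivialisations — `Ĝ` (`coordMetric`),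
`P = df` (`coordDeriv`), `T̂` (`coordTime`), the Gram form `Q = Pᵀ Ĝ P` (`coordGram`, positive definite by the hypothesis),
`c = A⁻¹ Ĝ(T̂, P ·)` (`coordCoeff`), `N = T̂ - P c` (`coordNormal`, normal and timelike), normalised (`coordUnitNormal`) and
transported back to `TM` (`smoothNormal`); at `x₀ = x` this DEFINES `futureUnitNormal`, and near `x₀` the transported field
equals `futureUnitNormal` by uniqueness of the future unit normal (`TimeOrientation.eq_of_isFutureUnitNormal`), whence
smoothness.  Used by the route `RootDecompTrappedGauge` (re-slicing: a smooth spacelike Cauchy hypersurface carries its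
future unit normal with `C^∞` lift, so the re-slicing door need not ask for it).  No named facts are introduced.

## References

* B. O'Neill, *Semi-Riemannian geometry with applications to relativity*, Academic Press 1983, Ch. 4, p. 99 and
  Lemma 4.19 ff. (local unit normal fields of semi-Riemannian hypersurfaces), Ch. 5, Lemma 5.26 and p. 145.
* R. M. Wald, *General Relativity*, 1984, §10.2 (the unit normal `n^a` of a spacelike hypersurface).
-/

noncomputable section

open Bundle Set Function Filter Module
open Literature.Geometry.Lorentzian
open scoped Manifold ContDiff Topology

set_option linter.dupNamespace false

-- D-0017: the namespace mirrors the Theorems path of this file (dupNamespace linter off above).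
namespace Summit.FinalStateConjecture.FinalStateConjecture.Theorems.SpacelikeNormalFieldCoord

universe u v

variable {n : ℕ} {X' : Type u} [TopologicalSpace X'] [ChartedSpace (EuclideanSpace ℝ (Fin n)) X']
  [IsManifold (𝓡 n) ∞ X'] (𝒮 : Spacetime.{v} (n + 1)) (f : X' → 𝒮.carrier) (x₀ : X')

/-! ### The map read in trivialisations -/

/-- **The metric read in the tangent trivialisation at `f x₀`, along `f`**: `Ĝ(x)(u, w) = g_{f x}(τ⁻¹ u, τ⁻¹ w)`. [folklore] -/
def coordMetric (x : X') :
    EuclideanSpace ℝ (Fin (n + 1)) →L[ℝ] EuclideanSpace ℝ (Fin (n + 1)) →L[ℝ] ℝ :=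
  (ContinuousLinearMap.precomp ℝ ((trivializationAt (EuclideanSpace ℝ (Fin (n + 1)))
    (TangentSpace (𝓡 (n + 1)) : 𝒮.carrier → Type _) (f x₀)).symmL ℝ (f x))).comp
    ((𝒮.metric.val (f x)).comp ((trivializationAt (EuclideanSpace ℝ (Fin (n + 1)))
      (TangentSpace (𝓡 (n + 1)) : 𝒮.carrier → Type _) (f x₀)).symmL ℝ (f x)))

omit [TopologicalSpace X'] [ChartedSpace (EuclideanSpace ℝ (Fin n)) X'] [IsManifold (𝓡 n) ∞ X'] in
/-- `Ĝ(x)(u, w) = g_{f x}(τ⁻¹ u, τ⁻¹ w)`. [folklore] -/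
theorem coordMetric_apply (x : X') (u w : EuclideanSpace ℝ (Fin (n + 1))) :
    coordMetric 𝒮 f x₀ x u w =
      𝒮.metric.val (f x) ((trivializationAt (EuclideanSpace ℝ (Fin (n + 1)))
        (TangentSpace (𝓡 (n + 1)) : 𝒮.carrier → Type _) (f x₀)).symmL ℝ (f x) u)
        ((trivializationAt (EuclideanSpace ℝ (Fin (n + 1)))
        (TangentSpace (𝓡 (n + 1)) : 𝒮.carrier → Type _) (f x₀)).symmL ℝ (f x) w) :=
  rfl

omit [TopologicalSpace X'] [ChartedSpace (EuclideanSpace ℝ (Fin n)) X'] [IsManifold (𝓡 n) ∞ X'] in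
/-- `Ĝ(x)` is symmetric. [folklore] -/
theorem coordMetric_symm (x : X') (u w : EuclideanSpace ℝ (Fin (n + 1))) :
    coordMetric 𝒮 f x₀ x u w = coordMetric 𝒮 f x₀ x w u := by
  rw [coordMetric_apply, coordMetric_apply, 𝒮.metric.symm]

/-- **The differential of `f` read in the tangent trivialisations at `x₀`, `f x₀`** (`inTangentCoordinates`):
`P(x) = τ_M ∘ df_x ∘ τ_X⁻¹`. [folklore] -/
def coordDeriv (x : X') : EuclideanSpace ℝ (Fin n) →L[ℝ] EuclideanSpace ℝ (Fin (n + 1)) :=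
  inTangentCoordinates (𝓡 n) (𝓡 (n + 1)) id f (fun x ↦ mfderiv (𝓡 n) (𝓡 (n + 1)) f x) x₀ x

/-- `P(x) u = τ_M (df_x (τ_X⁻¹ u))`. [folklore] -/
theorem coordDeriv_apply (x : X') (u : EuclideanSpace ℝ (Fin n)) :
    coordDeriv 𝒮 f x₀ x u = (trivializationAt (EuclideanSpace ℝ (Fin (n + 1)))
      (TangentSpace (𝓡 (n + 1)) : 𝒮.carrier → Type _) (f x₀)).continuousLinearMapAt ℝ (f x)
      (mfderiv (𝓡 n) (𝓡 (n + 1)) f x ((trivializationAt (EuclideanSpace ℝ (Fin n))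
        (TangentSpace (𝓡 n) : X' → Type _) x₀).symmL ℝ x u)) :=
  rfl

/-- **The orienting vector read in the trivialisation**: `T̂(x) = τ_M (T (f x))`. [folklore] -/
def coordTime (x : X') : EuclideanSpace ℝ (Fin (n + 1)) :=
  ((trivializationAt (EuclideanSpace ℝ (Fin (n + 1))) (TangentSpace (𝓡 (n + 1)) : 𝒮.carrier → Type _) (f x₀))
    (⟨f x, 𝒮.timeOrientation.vectorField (f x)⟩ : TangentBundle (𝓡 (n + 1)) 𝒮.carrier)).2

/-- **The Gram form** `Q(x)(u, w) = Ĝ(x)(P u, P w)`. [folklore] -/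
def coordGram (x : X') : EuclideanSpace ℝ (Fin n) →L[ℝ] EuclideanSpace ℝ (Fin n) →L[ℝ] ℝ :=
  (ContinuousLinearMap.precomp ℝ (coordDeriv 𝒮 f x₀ x)).comp
    ((coordMetric 𝒮 f x₀ x).comp (coordDeriv 𝒮 f x₀ x))

/-- `Q(x)(u, w) = Ĝ(x)(P u, P w)`. [folklore] -/
theorem coordGram_apply (x : X') (u w : EuclideanSpace ℝ (Fin n)) :
    coordGram 𝒮 f x₀ x u w = coordMetric 𝒮 f x₀ x (coordDeriv 𝒮 f x₀ x u) (coordDeriv 𝒮 f x₀ x w) :=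
  rfl

/-- **The functional** `β(x)(w) = Ĝ(x)(T̂, P w)`. [folklore] -/
def coordFunctional (x : X') : EuclideanSpace ℝ (Fin n) →L[ℝ] ℝ :=
  (coordMetric 𝒮 f x₀ x (coordTime 𝒮 f x₀ x)).comp (coordDeriv 𝒮 f x₀ x)

/-- `β(x)(w) = Ĝ(x)(T̂, P w)`. [folklore] -/
theorem coordFunctional_apply (x : X') (w : EuclideanSpace ℝ (Fin n)) :
    coordFunctional 𝒮 f x₀ x w = coordMetric 𝒮 f x₀ x (coordTime 𝒮 f x₀ x) (coordDeriv 𝒮 f x₀ x w) :=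
  rfl

/-- **The Gram operator** `A(x) = dualToVec ∘ Q(x) : ℝⁿ → ℝⁿ`. [folklore] -/
def coordOp (x : X') : EuclideanSpace ℝ (Fin n) →L[ℝ] EuclideanSpace ℝ (Fin n) :=
  (dualToVec n).comp (coordGram 𝒮 f x₀ x)

/-- **The tangential coefficients** `c(x) = A(x)⁻¹ (dualToVec β(x))`. [folklore] -/
def coordCoeff (x : X') : EuclideanSpace ℝ (Fin n) :=
  (coordOp 𝒮 f x₀ x).inverse (dualToVec n (coordFunctional 𝒮 f x₀ x))

/-- **The normal read in the trivialisation** `N(x) = T̂ - P c`. [folklore] -/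
def coordNormal (x : X') : EuclideanSpace ℝ (Fin (n + 1)) :=
  coordTime 𝒮 f x₀ x - coordDeriv 𝒮 f x₀ x (coordCoeff 𝒮 f x₀ x)

/-- **The unit normal read in the trivialisation** `ν̂(x) = N / √(-Ĝ(N, N))`. [folklore] -/
def coordUnitNormal (x : X') : EuclideanSpace ℝ (Fin (n + 1)) :=
  (Real.sqrt (-(coordMetric 𝒮 f x₀ x (coordNormal 𝒮 f x₀ x) (coordNormal 𝒮 f x₀ x))))⁻¹ •
    coordNormal 𝒮 f x₀ x

/-- **The transported unit normal** `ν̃(x) = τ_M⁻¹ ν̂(x) ∈ T_{f x} M` (smooth in `x` near `x₀`). [folklore] -/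
def smoothNormal (x : X') : TangentSpace (𝓡 (n + 1)) (f x) :=
  (trivializationAt (EuclideanSpace ℝ (Fin (n + 1))) (TangentSpace (𝓡 (n + 1)) : 𝒮.carrier → Type _) (f x₀)).symmL ℝ
    (f x) (coordUnitNormal 𝒮 f x₀ x)

/-- **The future unit normal field of `f`**: the transported unit normal based at the point itself,
`ν(x) = ν̃_{x₀ := x}(x)`. [cite: ONeill1983, Ch. 4, Lemma 4.19 ff.; Ch. 5, p. 145] -/
def futureUnitNormal : NormalField (𝓡 (n + 1)) f := fun x ↦ smoothNormal 𝒮 f x x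

/-! ### Smoothness of the coordinate expressions at `x₀` -/

variable {f} (hf : ContMDiff (𝓡 n) (𝓡 (n + 1)) ∞ f)
include hf

omit [IsManifold (𝓡 n) ∞ X'] in
/-- **`Ĝ` is smooth at `x₀`** (the metric is a smooth section of the bundle of bilinear forms; `contMDiffAt_bilin_iff` along
the base map `f`). [folklore] -/
theorem contMDiffAt_coordMetric :
    ContMDiffAt (𝓡 n) 𝓘(ℝ, EuclideanSpace ℝ (Fin (n + 1)) →L[ℝ] EuclideanSpace ℝ (Fin (n + 1)) →L[ℝ] ℝ)
      ∞ (coordMetric 𝒮 f x₀) x₀ := by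
  have h : ContMDiffAt (𝓡 n) ((𝓡 (n + 1)).prod 𝓘(ℝ, EuclideanSpace ℝ (Fin (n + 1)) →L[ℝ]
      EuclideanSpace ℝ (Fin (n + 1)) →L[ℝ] ℝ)) ∞ (fun x ↦ TotalSpace.mk'
        (EuclideanSpace ℝ (Fin (n + 1)) →L[ℝ] EuclideanSpace ℝ (Fin (n + 1)) →L[ℝ] ℝ)
        (E := fun b : 𝒮.carrier ↦ TangentSpace (𝓡 (n + 1)) b →L[ℝ]
          TangentSpace (𝓡 (n + 1)) b →L[ℝ] ℝ) (f x) (𝒮.metric.val (f x))) x₀ :=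
    (𝒮.metric.contMDiff (f x₀)).comp x₀ (hf x₀)
  exact ((contMDiffAt_bilin_iff (IX := 𝓡 n) (IB := 𝓡 (n + 1))
    (V := (TangentSpace (𝓡 (n + 1)) : 𝒮.carrier → Type _)) (b := f)
    (s := fun x ↦ 𝒮.metric.val (f x)) (x₀ := x₀)).1 h).2

/-- **`P` is smooth at `x₀`** (`ContMDiffAt.mfderiv_const`). [folklore] -/
theorem contMDiffAt_coordDeriv :
    ContMDiffAt (𝓡 n) 𝓘(ℝ, EuclideanSpace ℝ (Fin n) →L[ℝ] EuclideanSpace ℝ (Fin (n + 1))) ∞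
      (coordDeriv 𝒮 f x₀) x₀ :=
  ContMDiffAt.mfderiv_const (hf x₀) le_rfl

omit [IsManifold (𝓡 n) ∞ X'] in
/-- **`T̂` is smooth at `x₀`** (the fibre coordinate of the smooth map `x ↦ T(f x)` into `TM`). [folklore] -/
theorem contMDiffAt_coordTime :
    ContMDiffAt (𝓡 n) 𝓘(ℝ, EuclideanSpace ℝ (Fin (n + 1))) ∞ (coordTime 𝒮 f x₀) x₀ := by
  have h : ContMDiffAt (𝓡 n) (𝓡 (n + 1)).tangent ∞ (fun x ↦ (⟨f x,
      𝒮.timeOrientation.vectorField (f x)⟩ : TangentBundle (𝓡 (n + 1)) 𝒮.carrier)) x₀ :=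
    (𝒮.timeOrientation.contMDiff (f x₀)).comp x₀ (hf x₀)
  exact (contMDiffAt_totalSpace.1 h).2

/-- `Q` is smooth at `x₀`. [folklore] -/
theorem contMDiffAt_coordGram :
    ContMDiffAt (𝓡 n) 𝓘(ℝ, EuclideanSpace ℝ (Fin n) →L[ℝ] EuclideanSpace ℝ (Fin n) →L[ℝ] ℝ) ∞
      (coordGram 𝒮 f x₀) x₀ :=
  ((contMDiffAt_coordDeriv 𝒮 x₀ hf).clm_precomp (F₃ := ℝ)).clm_comp
    ((contMDiffAt_coordMetric 𝒮 x₀ hf).clm_comp (contMDiffAt_coordDeriv 𝒮 x₀ hf))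

/-- `β` is smooth at `x₀`. [folklore] -/
theorem contMDiffAt_coordFunctional :
    ContMDiffAt (𝓡 n) 𝓘(ℝ, EuclideanSpace ℝ (Fin n) →L[ℝ] ℝ) ∞ (coordFunctional 𝒮 f x₀) x₀ :=
  ((contMDiffAt_coordMetric 𝒮 x₀ hf).clm_apply (contMDiffAt_coordTime 𝒮 x₀ hf)).clm_comp
    (contMDiffAt_coordDeriv 𝒮 x₀ hf)

/-- `A` is smooth at `x₀`. [folklore] -/
theorem contMDiffAt_coordOp :
    ContMDiffAt (𝓡 n) 𝓘(ℝ, EuclideanSpace ℝ (Fin n) →L[ℝ] EuclideanSpace ℝ (Fin n)) ∞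
      (coordOp 𝒮 f x₀) x₀ :=
  contMDiffAt_const.clm_comp (contMDiffAt_coordGram 𝒮 x₀ hf)

omit hf

/-! ### Pointwise algebra at the points of the two chart domains -/

variable {x₀}

omit [TopologicalSpace X'] [ChartedSpace (EuclideanSpace ℝ (Fin n)) X'] [IsManifold (𝓡 n) ∞ X'] in
/-- Base-set membership for the trivialisation of `TM` at `f x₀`. [folklore] -/
theorem mem_baseSet_of_mem {x : X'}
    (hxM : f x ∈ (chartAt (EuclideanSpace ℝ (Fin (n + 1))) (f x₀)).source) :
    f x ∈ (trivializationAt (EuclideanSpace ℝ (Fin (n + 1))) (TangentSpace (𝓡 (n + 1)) : 𝒮.carrier → Type _)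
      (f x₀)).baseSet := by
  rw [TangentBundle.trivializationAt_baseSet]; exact hxM

-- (census desk, dedup cure `dedup.landed`: the base-set lemma for the trivialisation of `TX` at `x₀` is the landed
-- `Literature.Geometry.Lorentzian.DataEmbedding.mem_baseSet_of_mem'` (module `DataEmbeddingNormalSmooth`, imported above);
-- the verbatim local copy of lens-4's packet was deleted and its two call sites (here and in Part 2) cite the landed declaration.)

omit [TopologicalSpace X'] [ChartedSpace (EuclideanSpace ℝ (Fin n)) X'] [IsManifold (𝓡 n) ∞ X'] in
/-- `τ_M⁻¹ T̂(x) = T(f x)`. [folklore] -/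
theorem symmL_coordTime {x : X'}
    (hxM : f x ∈ (chartAt (EuclideanSpace ℝ (Fin (n + 1))) (f x₀)).source) :
    (trivializationAt (EuclideanSpace ℝ (Fin (n + 1))) (TangentSpace (𝓡 (n + 1)) : 𝒮.carrier → Type _)
      (f x₀)).symmL ℝ (f x) (coordTime 𝒮 f x₀ x) = 𝒮.timeOrientation.vectorField (f x) := by
  have hb := mem_baseSet_of_mem 𝒮 hxM
  rw [coordTime, ← Trivialization.continuousLinearMapAt_apply_of_mem (R := ℝ) (hb := hb),
    Trivialization.symmL_continuousLinearMapAt _ hb]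

/-- `τ_M⁻¹ (P(x) u) = df_x (τ_X⁻¹ u)`. [folklore] -/
theorem symmL_coordDeriv {x : X'}
    (hxM : f x ∈ (chartAt (EuclideanSpace ℝ (Fin (n + 1))) (f x₀)).source)
    (u : EuclideanSpace ℝ (Fin n)) :
    (trivializationAt (EuclideanSpace ℝ (Fin (n + 1))) (TangentSpace (𝓡 (n + 1)) : 𝒮.carrier → Type _)
      (f x₀)).symmL ℝ (f x) (coordDeriv 𝒮 f x₀ x u) =
      mfderiv (𝓡 n) (𝓡 (n + 1)) f x ((trivializationAt (EuclideanSpace ℝ (Fin n))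
        (TangentSpace (𝓡 n) : X' → Type _) x₀).symmL ℝ x u) := by
  rw [coordDeriv_apply, Trivialization.symmL_continuousLinearMapAt _ (mem_baseSet_of_mem 𝒮 hxM)]

/-- **The Gram form is the induced form read in the trivialisation of `TX`**:
`Q(x)(u, w) = g(df τ_X⁻¹ u, df τ_X⁻¹ w)`. [folklore] -/
theorem coordGram_apply_eq {x : X'}
    (hxM : f x ∈ (chartAt (EuclideanSpace ℝ (Fin (n + 1))) (f x₀)).source)
    (u w : EuclideanSpace ℝ (Fin n)) :
    coordGram 𝒮 f x₀ x u w = 𝒮.metric.val (f x)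
      (mfderiv (𝓡 n) (𝓡 (n + 1)) f x ((trivializationAt (EuclideanSpace ℝ (Fin n))
        (TangentSpace (𝓡 n) : X' → Type _) x₀).symmL ℝ x u))
      (mfderiv (𝓡 n) (𝓡 (n + 1)) f x ((trivializationAt (EuclideanSpace ℝ (Fin n))
        (TangentSpace (𝓡 n) : X' → Type _) x₀).symmL ℝ x w)) := by
  rw [coordGram_apply, coordMetric_apply, symmL_coordDeriv 𝒮 hxM, symmL_coordDeriv 𝒮 hxM]

/- Positive-definiteness hypothesis on the differential: `0 < g(df v, df v)` for `v ≠ 0` (holds for spacelike immersions,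
`val_mfderiv_pos_of_isSpacelikeImmersion`). -/
variable (hpos : ∀ (x : X') (v : TangentSpace (𝓡 n) x), v ≠ 0 →
  0 < 𝒮.metric.val (f x) (mfderiv (𝓡 n) (𝓡 (n + 1)) f x v) (mfderiv (𝓡 n) (𝓡 (n + 1)) f x v))
include hpos

/-- `Q(x)(u, u) ≥ 0`. [folklore] -/
theorem coordGram_nonneg {x : X'}
    (hxM : f x ∈ (chartAt (EuclideanSpace ℝ (Fin (n + 1))) (f x₀)).source)
    (u : EuclideanSpace ℝ (Fin n)) : 0 ≤ coordGram 𝒮 f x₀ x u u := by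
  rw [coordGram_apply_eq 𝒮 hxM]
  by_cases hu : (trivializationAt (EuclideanSpace ℝ (Fin n)) (TangentSpace (𝓡 n) : X' → Type _) x₀).symmL ℝ x u = 0
  · simp [hu]
  · exact (hpos x _ hu).le

/-- `Q(x)(u, u) = 0` forces `u = 0` (positivity, injectivity of `τ_X⁻¹`). [folklore] -/
theorem eq_zero_of_coordGram_self_eq_zero {x : X'}
    (hxX : x ∈ (chartAt (EuclideanSpace ℝ (Fin n)) x₀).source)
    (hxM : f x ∈ (chartAt (EuclideanSpace ℝ (Fin (n + 1))) (f x₀)).source)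
    {u : EuclideanSpace ℝ (Fin n)} (hu : coordGram 𝒮 f x₀ x u u = 0) : u = 0 := by
  rw [coordGram_apply_eq 𝒮 hxM] at hu
  have h0 : (trivializationAt (EuclideanSpace ℝ (Fin n)) (TangentSpace (𝓡 n) : X' → Type _) x₀).symmL ℝ x u = 0 := by
    by_contra hne
    exact (hpos x _ hne).ne' hu
  have h := congrArg ((trivializationAt (EuclideanSpace ℝ (Fin n)) (TangentSpace (𝓡 n) : X' → Type _)
    x₀).continuousLinearMapAt ℝ x) h0
  rwa [Trivialization.continuousLinearMapAt_symmL _ (DataEmbedding.mem_baseSet_of_mem' hxX), map_zero] at h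

/-- **The Gram operator is invertible** at the points of the two chart domains. [folklore] -/
theorem isInvertible_coordOp {x : X'}
    (hxX : x ∈ (chartAt (EuclideanSpace ℝ (Fin n)) x₀).source)
    (hxM : f x ∈ (chartAt (EuclideanSpace ℝ (Fin (n + 1))) (f x₀)).source) :
    (coordOp 𝒮 f x₀ x).IsInvertible := by
  have hinj : Injective (coordOp 𝒮 f x₀ x) := by
    refine (injective_iff_map_eq_zero _).2 fun u hu ↦ ?_
    have h1 : dualToVec n (coordGram 𝒮 f x₀ x u) = dualToVec n 0 := by
      rw [map_zero]; exact hu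
    have h2 : coordGram 𝒮 f x₀ x u = 0 := dualToVec_injective n h1
    exact eq_zero_of_coordGram_self_eq_zero 𝒮 hpos hxX hxM (by rw [h2]; rfl)
  refine JetRigidity.isInvertible_of_bijective ⟨hinj, ?_⟩
  exact (LinearMap.injective_iff_surjective_of_finrank_eq_finrank
    (f := (coordOp 𝒮 f x₀ x : EuclideanSpace ℝ (Fin n) →ₗ[ℝ] EuclideanSpace ℝ (Fin n))) rfl).1 hinj

/-- **The defining equation of the tangential coefficients**: `Q(x)(c, w) = Ĝ(x)(T̂, P w)`. [folklore] -/
theorem coordGram_coordCoeff {x : X'}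
    (hxX : x ∈ (chartAt (EuclideanSpace ℝ (Fin n)) x₀).source)
    (hxM : f x ∈ (chartAt (EuclideanSpace ℝ (Fin (n + 1))) (f x₀)).source)
    (w : EuclideanSpace ℝ (Fin n)) :
    coordGram 𝒮 f x₀ x (coordCoeff 𝒮 f x₀ x) w = coordFunctional 𝒮 f x₀ x w := by
  obtain ⟨e, he⟩ := isInvertible_coordOp 𝒮 hpos hxX hxM
  have h1 : coordOp 𝒮 f x₀ x (coordCoeff 𝒮 f x₀ x) = dualToVec n (coordFunctional 𝒮 f x₀ x) := by
    rw [coordCoeff, ← he, ContinuousLinearMap.inverse_equiv]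
    exact e.apply_symm_apply _
  have h2 : coordGram 𝒮 f x₀ x (coordCoeff 𝒮 f x₀ x) = coordFunctional 𝒮 f x₀ x :=
    dualToVec_injective n h1
  rw [h2]

/-- **`N` is normal**: `Ĝ(x)(N, P w) = 0`. [folklore] -/
theorem coordMetric_coordNormal_coordDeriv {x : X'}
    (hxX : x ∈ (chartAt (EuclideanSpace ℝ (Fin n)) x₀).source)
    (hxM : f x ∈ (chartAt (EuclideanSpace ℝ (Fin (n + 1))) (f x₀)).source)
    (w : EuclideanSpace ℝ (Fin n)) :
    coordMetric 𝒮 f x₀ x (coordNormal 𝒮 f x₀ x) (coordDeriv 𝒮 f x₀ x w) = 0 := by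
  have e1 : coordMetric 𝒮 f x₀ x (coordNormal 𝒮 f x₀ x) (coordDeriv 𝒮 f x₀ x w) =
      coordMetric 𝒮 f x₀ x (coordTime 𝒮 f x₀ x) (coordDeriv 𝒮 f x₀ x w) -
        coordMetric 𝒮 f x₀ x (coordDeriv 𝒮 f x₀ x (coordCoeff 𝒮 f x₀ x)) (coordDeriv 𝒮 f x₀ x w) := by
    simp only [coordNormal, map_sub, FunLike.coe_sub, Pi.sub_apply]
  rw [e1, ← coordFunctional_apply, ← coordGram_apply, coordGram_coordCoeff 𝒮 hpos hxX hxM, sub_self]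

/-- `Ĝ(x)(N, N) = Ĝ(x)(T̂, T̂) - Q(x)(c, c)`. [folklore] -/
theorem coordMetric_coordNormal_self {x : X'}
    (hxX : x ∈ (chartAt (EuclideanSpace ℝ (Fin n)) x₀).source)
    (hxM : f x ∈ (chartAt (EuclideanSpace ℝ (Fin (n + 1))) (f x₀)).source) :
    coordMetric 𝒮 f x₀ x (coordNormal 𝒮 f x₀ x) (coordNormal 𝒮 f x₀ x) =
      coordMetric 𝒮 f x₀ x (coordTime 𝒮 f x₀ x) (coordTime 𝒮 f x₀ x) -
        coordGram 𝒮 f x₀ x (coordCoeff 𝒮 f x₀ x) (coordCoeff 𝒮 f x₀ x) := by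
  have h1 : coordMetric 𝒮 f x₀ x (coordTime 𝒮 f x₀ x) (coordDeriv 𝒮 f x₀ x (coordCoeff 𝒮 f x₀ x)) =
      coordGram 𝒮 f x₀ x (coordCoeff 𝒮 f x₀ x) (coordCoeff 𝒮 f x₀ x) := by
    rw [← coordFunctional_apply, coordGram_coordCoeff 𝒮 hpos hxX hxM]
  have h2 : coordMetric 𝒮 f x₀ x (coordDeriv 𝒮 f x₀ x (coordCoeff 𝒮 f x₀ x)) (coordTime 𝒮 f x₀ x) =
      coordGram 𝒮 f x₀ x (coordCoeff 𝒮 f x₀ x) (coordCoeff 𝒮 f x₀ x) := by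
    rw [coordMetric_symm, h1]
  have h3 : coordMetric 𝒮 f x₀ x (coordDeriv 𝒮 f x₀ x (coordCoeff 𝒮 f x₀ x))
      (coordDeriv 𝒮 f x₀ x (coordCoeff 𝒮 f x₀ x)) =
      coordGram 𝒮 f x₀ x (coordCoeff 𝒮 f x₀ x) (coordCoeff 𝒮 f x₀ x) := rfl
  have e1 : coordMetric 𝒮 f x₀ x (coordNormal 𝒮 f x₀ x) (coordNormal 𝒮 f x₀ x) =
      coordMetric 𝒮 f x₀ x (coordTime 𝒮 f x₀ x) (coordTime 𝒮 f x₀ x) -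
        coordMetric 𝒮 f x₀ x (coordTime 𝒮 f x₀ x) (coordDeriv 𝒮 f x₀ x (coordCoeff 𝒮 f x₀ x)) -
        (coordMetric 𝒮 f x₀ x (coordDeriv 𝒮 f x₀ x (coordCoeff 𝒮 f x₀ x)) (coordTime 𝒮 f x₀ x) -
          coordMetric 𝒮 f x₀ x (coordDeriv 𝒮 f x₀ x (coordCoeff 𝒮 f x₀ x))
            (coordDeriv 𝒮 f x₀ x (coordCoeff 𝒮 f x₀ x))) := by
    simp only [coordNormal, map_sub, FunLike.coe_sub, Pi.sub_apply]
    ring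
  rw [e1, h1, h2, h3]
  ring

end Summit.FinalStateConjecture.FinalStateConjecture.Theorems.SpacelikeNormalFieldCoord

end
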